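import Summits.Ventures.PercRepro.S2ThirteenSevenSpreadFour
import Summits.Ventures.PercRepro.S1CoreCapSpreadChainRows

/-!
# PercRepro — S2: THE SPREAD ROWS `t ≤ 4` OF THE CELL `(13, 7)`, UNCONDITIONAL (p7, gen 16; sub-claim S2)

**`c025_thirteen_seven_cf_spread_le_four`**: on every coloop-free spread `e`-free core of rank `13` on `20` points with at most
`4` triangles, `RLS M 13 5` — the rows `t ≤ 3` (`c025_thirteen_seven_cf_spread_le_three_of_cap`) and `t = 4`
(`c025_thirteen_seven_cf_spread_four_of_cap`) with their cap `s₄ ≤ 41` discharged by p1 g33's nullity-`7` spread chain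
(`S1.ncard_fourCircuits_le_forty_one_spread_twenty`, S1CoreCapSpreadChainRows). The rows `t ≥ 5`, the concentrated cases and
the coloop sub-cells of `(13, 7)` stay OPEN; nothing about the cell is claimed. Axioms: standard.
-/

open scoped Matroid

namespace PercRepro

namespace ThmN

open Set

variable {α : Type}

/-- **The spread rows `t ≤ 4` of the coloop-free cell `(13, 7)`**, with the spread cap `s₄ ≤ 41` in the tree. -/
theorem c025_thirteen_seven_cf_spread_le_four (M : Matroid α) [M.Finite]
    (hR : M.eRank = ((13 : ℕ) : ℕ∞)) (hn : M.E.ncard = 13 + 7)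
    (hfree : ∀ e ∈ M.E, ∃ A ⊆ M.E \ {e}, e ∉ M.closure A ∧ e ∉ M.closure ((M.E \ {e}) \ A)) (hK : ∀ e, ¬ M.IsColoop e)
    (h4 : ¬ ∃ W ⊆ M.E, W.ncard ≤ 9 ∧ W.encard = M.eRk W + 4)
    (ht4 : {C : Set α | M.IsCircuit C ∧ C.ncard = 3}.ncard ≤ 4) : RLS M 13 5 := by
  have hd : M.E.encard = M.eRank + 7 := by
    rw [hR, ← M.ground_finite.cast_ncard_eq, hn]
    push_cast
    ring
  have hs4c := S1.ncard_fourCircuits_le_forty_one_spread_twenty M hfree h4 hd hn hK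
  by_cases ht3 : {C : Set α | M.IsCircuit C ∧ C.ncard = 3}.ncard ≤ 3
  · exact c025_thirteen_seven_cf_spread_le_three_of_cap M hR hn hfree hK h4 hs4c ht3
  · exact c025_thirteen_seven_cf_spread_four_of_cap M hR hn hfree hK h4 hs4c (by omega)

end ThmN

end PercRepro
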